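import Summits.BirchSwinnertonDyer.BirchSwinnertonDyer.Theorems.PrintX11aUpperNonSurjFiveExcMultiStab
import HarnessLib

/-!
# Crux U5 `PrintX11a.UpperNonSurjFive` (item stmt-BirchSwinnertonDyer-20614), line «gl1cartan5», EXCEPTIONAL-ZERO road:
# the `k`-fold stabilisation WITHOUT Coleman–Edixhoven — the decision `α_ℓ ≠ β_ℓ` as an abstract binder, and its
# CONGRUENCE discharge at the primes `ℓ ≢ 1 (mod p)` (in particular at `ℓ = p`)

INPUTS desk `bsd-inputs` (D-0154 (2)), seat `bsd-inputs-honda-p1` (resident INPUTS prover), tranche T-G116 of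
`INPUTS-LIST-2-ADDENDUM-63 §A`; `--supports stmt-BirchSwinnertonDyer-20614`, closes nothing. Companion of
`…ExcMultiStab` (file 3 of the EXCEPTIONAL-ZERO road, `GL1Cartan.Exc.exists_multiStab`), whose ONLY use of the named fact
`colemanEdixhoven1998_heckePolynomial_simpleRoots` (Coleman–Edixhoven 1998 Thm. 2.1, G116 of the INPUTS list) is the decision
«`α_ℓ ≠ β_ℓ` for the roots of `X² − a_ℓ(g)X + ℓ`» at each stabilisation prime `ℓ ∣ D` (Vatsal's Condition 1 for the stabilised
form). On the road that decision comes with a CONGRUENCE: `a_ℓ(g) ≡ u_ℓ(ℓ + 1)` and `β_ℓ ≡ u_ℓ ℓ` (`u_ℓ = a_ℓ(E) = ±1`), so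
`α_ℓ = a_ℓ(g) − β_ℓ ≡ u_ℓ`; hence `α_ℓ = β_ℓ` forces `u_ℓ(ℓ − 1) ≡ 0 (mod 𝔪)`, i.e. `ℓ ≡ 1 (mod p)`. So the decision is FREE
at every `ℓ ≢ 1 (mod p)` — in particular at `ℓ = p` itself (`p % p = 0`) — exactly as in the `p = 3` precedent
`KimAtThreeDeepLowerOffStratumLevelLoweringConditionOne.sub_ne_of_mod_three_ne_one` (there `u = 1`; files `…RibetRowsFinal`
«`q ≢ 1 (mod 3)`, ten facts» versus `…RibetRowsCE` «every `q`, eleven facts»).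

* §1 `sub_ne_of_emod_ne_one` — `a ≡ u(q + 1)`, `β ≡ uq`, `u² = 1`, `q % p ≠ 1` ⟹ `a − β ≠ β` (any prime `p`, any `q : ℕ`).
* §2 `exists_multiStab_of_rootNe` — `exists_multiStab` with the decision on `D` as an ABSTRACT binder (proof copied letter for
  letter; Coleman–Edixhoven, the congruence, or any future producer plug in); `exists_multiStab_of_emod_ne_one` — the CE-FREE
  `k`-fold stabilisation when every prime `q ∣ D` has `q % p ≠ 1`.

SCOPE (honest): on the exceptional-zero road `D` is NOT an auxiliary supply — it is the squarefree product of the multiplicative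
primes `ℓ ≠ p` at which `E[p]` is unramified (`Exc.exists_unramifiedMultDecomposition`), forced by the optimal-level currency of
`ribet1990_levelLowering_gamma0_newform_general_of_five_le`; at such an `ℓ ≡ 1 (mod p)` Coleman–Edixhoven stays load-bearing.
Theorems only; no definition, no named fact, no `sorry`; nothing here proves Coleman–Edixhoven 1998 Thm. 2.1; BSD is not proved
by any of this.

## References

* V. Vatsal, Duke Math. J. 98 (1999), (1.2) Condition 1 [Vatsal1999]; R. F. Coleman, B. Edixhoven, Math. Ann. 310 (1998), Thm. 2.1
  [ColemanEdixhoven1998]; F. Diamond, J. Shurman (2005), §5.7, Prop. 5.6.2 [DiamondShurman2005]; G. Shimura (1971), Thm. 3.48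
  [Shimura1971]; R. Greenberg, V. Vatsal, Invent. Math. 142 (2000), §3 Lemma (3.6) [GreenbergVatsal2000].
-/

set_option autoImplicit false
-- the Theorems namespace of a single-conjunct summit repeats the summit name by design (D-0017)
set_option linter.dupNamespace false

noncomputable section

open scoped MatrixGroups ModularForm Classical NNReal

open CongruenceSubgroup WeierstrassCurve Literature.NumberTheory.EllipticCurves
  Literature.NumberTheory.EllipticCurves.ModularForms
open UpperHalfPlane hiding I

namespace Summit.BirchSwinnertonDyer.BirchSwinnertonDyer.Theorems.GL1Cartan.Exc

open Literature.NumberTheory.EllipticCurves.ModularForms.DeligneSerreLift (norm_intCast_le_one)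
open Summit.BirchSwinnertonDyer.BirchSwinnertonDyer.Theorems.KimAtThreeDeepLowerOffStratumLevelLoweringConditionOne
  (hasSimpleHeckeGenEigenspace_of_isNewform0)
open Summit.BirchSwinnertonDyer.BirchSwinnertonDyer.Theorems.KimAtThreeDeepLowerOffStratumLevelLoweringVatsalStab
  (cuspCoeff_stab isNormalized_stab)
open Summit.BirchSwinnertonDyer.BirchSwinnertonDyer.Theorems.KimAtThreeDeepLowerOffStratumLevelLoweringStabEigenform
  renaming heckeT_stab_of_ne → heckeT_stab_of_ne_eig, heckeT_stab_self → heckeT_stab_self_eig,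
    isHeckeEigenform_stab → isHeckeEigenform_stab_eig, cuspCoeff_stab_prime → cuspCoeff_stab_prime_eig,
    cuspCoeff_mul_cuspCoeff → cuspCoeff_mul_cuspCoeff_eig, heckeEigenvalue_stab → heckeEigenvalue_stab_eig,
    valuation_cuspCoeff_stab_le_one → valuation_cuspCoeff_stab_le_one_three,
    finiteDimensional_coeffField_stab → finiteDimensional_coeffField_stab_eig
open Summit.BirchSwinnertonDyer.BirchSwinnertonDyer.Theorems.KimAtThreeDeepLowerOffStratumLevelLoweringStabCanonicalPeriod
  (cuspCoeff_iota_im_eq_zero)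
open Summit.BirchSwinnertonDyer.BirchSwinnertonDyer.Theorems.KimAtThreeDeepLowerOffStratumLevelLoweringMultiStabConditionOne
  (hasSimpleHeckeGenEigenspace_stab_of_hasSimpleHeckeGenEigenspace)
open Summit.BirchSwinnertonDyer.BirchSwinnertonDyer.Theorems.KimAtThreeDeepLowerOffStratumLevelLoweringMultiStabData
  (iota_mem_span_realEigen)

/-! ### §1 The decision `α ≠ β` is free at `q ≢ 1 (mod p)` -/

section Congruence

variable {p : ℕ} [Fact p.Prime]

/-- **`α ≠ β` is free when `q ≢ 1 (mod p)`** (any sign `u = ±1`): if `a ≡ u(q + 1)` and `β ≡ uq` modulo the maximal ideal of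
`𝒪_{ℚ̄_p}` (through `ι⁻¹`), then `α = a − β ≡ u`, and `α = β` would give `u(q − 1) = (a − u(q + 1)) − 2(β − uq) ≡ 0`, i.e.
`p ∣ q − 1`. At `q = p` (`p % p = 0 ≠ 1`) this is the statement «the ordinary root `α ≡ u` and `β ≡ 0` differ». The
`p = 3`, `u = 1` case is `KimAtThreeDeepLowerOffStratumLevelLoweringConditionOne.sub_ne_of_mod_three_ne_one`. [folklore] -/
theorem sub_ne_of_emod_ne_one (ι : PadicAlgCl p ≃+* ℂ) {a β : ℂ} {q : ℕ} {u : ℤ} (hu : u * u = 1) (hq1 : q % p ≠ 1)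
    (haq : Valued.v (ι.symm (a - u * (q + 1))) < 1) (hβq : Valued.v (ι.symm (β - u * q)) < 1) : a - β ≠ β := by
  have hp : p.Prime := Fact.out
  intro h
  have hq : (((u * ((q : ℤ) - 1) : ℤ)) : PadicAlgCl p) = ι.symm (a - u * (q + 1)) - 2 * ι.symm (β - u * q) := by
    have ha : a = 2 * β := by linear_combination h
    simp only [map_sub, map_add, map_mul, map_natCast, map_one, map_ofNat, map_intCast, ha]
    push_cast
    ring
  have h2 : ‖(2 : PadicAlgCl p) * ι.symm (β - u * q)‖ < 1 := by
    rw [norm_mul]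
    have h2' : ‖(2 : PadicAlgCl p)‖ ≤ 1 := by
      have := norm_intCast_le_one (p := p) (2 : ℤ); simpa using this
    exact mul_lt_one_of_nonneg_of_lt_one_right h2' (norm_nonneg _) (valuation_lt_one_iff.mp hβq)
  have hlt : ‖(((u * ((q : ℤ) - 1) : ℤ)) : PadicAlgCl p)‖ < 1 := by
    rw [hq, sub_eq_add_neg]
    refine lt_of_le_of_lt (PadicAlgCl.isNonarchimedean p _ _) (max_lt (valuation_lt_one_iff.mp haq) ?_)
    rwa [norm_neg]
  rw [show (((u * ((q : ℤ) - 1) : ℤ)) : PadicAlgCl p) = ((((u * ((q : ℤ) - 1) : ℤ)) : ℚ_[p]) : PadicAlgCl p) by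
      push_cast; rfl, PadicAlgCl.norm_extends, Padic.norm_intCast_lt_one_iff] at hlt
  -- `p ∣ u(q − 1)` with `u = ±1`, so `p ∣ q − 1`, i.e. `q ≡ 1 (mod p)`
  have hdvd : (p : ℤ) ∣ (q : ℤ) - 1 := by
    rcases Int.eq_one_or_neg_one_of_mul_eq_one hu with rfl | rfl
    · simpa only [one_mul] using hlt
    · rw [neg_mul, one_mul, dvd_neg] at hlt
      exact hlt
  have hmod : 1 ≡ q [MOD p] := (Nat.modEq_iff_dvd).mpr (by simpa only [Nat.cast_one] using hdvd)
  have h1q : q % p = 1 % p := hmod.symm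
  exact hq1 (by rw [h1q, Nat.mod_eq_of_lt hp.one_lt])

end Congruence

/-! ### §2 The `k`-fold stabilisation with the decision as a binder, and its CE-free instance -/

section Induction

variable {p : ℕ} [Fact p.Prime] {M₀ : ℕ} [NeZero M₀] {g : CuspForm (Gamma0 M₀) 2} (hg : IsNewform0 g)
include hg

/-- ★ **THE `k`-FOLD STABILISATION of the optimal-level newform, with the decision `α_q ≠ β_q` on `D` as a BINDER.** Let
`g ∈ S₂(Γ₀(M₀))` be a newform, `D` squarefree and prime to `M₀`, and suppose that at every prime `q ∣ D` there is a sign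
`u_q = ±1` with `af q = u_q` and `a_q(g) ≡ u_q(q + 1)` (through `ι⁻¹`), AND that for every such `q`, sign `u` and every root `β`
of `X² − a_q(g)X + q` with `β ≡ uq` one has DECIDED `a_q(g) − β ≠ β` (the binder `hdec`; from Coleman–Edixhoven BY NAME this is
`exists_multiStab`, from the congruence at `q ≢ 1 (mod p)` it is `exists_multiStab_of_emod_ne_one`). Then at level `L = M₀ D`
there is a normalised Hecke eigenform `G` with `p`-integral coefficients in a number field, satisfying Vatsal's Condition 1,
`a_q(G) = a_q(g)` for primes `q ∤ D`, `a_q(G) ≡ af q` for primes `q ∣ D`, lying in the complex span of the real-coefficient forms of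
level `L` on which every `T_r`, `r ∤ L`, acts by `a_r(g)`. Proof: that of `exists_multiStab`, letter for letter, the decision read
from `hdec`. [cite: Vatsal1999, (1.2) Condition 1] [cite: DiamondShurman2005, §5.7 and Prop. 5.6.2] [cite: Shimura1971, Thm. 3.48] -/
theorem exists_multiStab_of_rootNe (ι : PadicAlgCl p ≃+* ℂ) (af : ℕ → ℂ) :
    ∀ (D : ℕ), Squarefree D → Nat.Coprime D M₀ →
      (∀ q : ℕ, q.Prime → q ∣ D → ∃ u : ℤ, u * u = 1 ∧ af q = u ∧
        Valued.v (ι.symm (cuspCoeff g q - u * (q + 1))) < 1) →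
      (∀ q : ℕ, q.Prime → q ∣ D → ∀ (u : ℤ) (β : ℂ), u * u = 1 → af q = u →
        Valued.v (ι.symm (cuspCoeff g q - u * (q + 1))) < 1 → β ^ 2 - cuspCoeff g q * β + q = 0 →
        Valued.v (ι.symm (β - u * q)) < 1 → cuspCoeff g q - β ≠ β) →
      ∀ (L : ℕ) [NeZero L], L = M₀ * D →
        ∃ G : CuspForm (Gamma0 L) 2,
          IsHeckeEigenform G ∧ IsNormalized G ∧ (∀ n : ℕ, Valued.v (ι.symm (cuspCoeff G n)) ≤ 1) ∧
          FiniteDimensional ℚ (coeffField G) ∧ HasSimpleHeckeGenEigenspace G ∧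
          (∀ q : ℕ, q.Prime → ¬ q ∣ D → cuspCoeff G q = cuspCoeff g q) ∧
          (∀ q : ℕ, q.Prime → q ∣ D → Valued.v (ι.symm (af q - cuspCoeff G q)) < 1) ∧
          G ∈ Submodule.span ℂ {ψ : CuspForm (Gamma0 L) 2 | (∀ m, (cuspCoeff ψ m).im = 0) ∧
            ∀ (r : ℕ) (hr : r.Prime), ¬ r ∣ L →
              (haveI : NeZero r := ⟨hr.ne_zero⟩; heckeT (Gamma0 L) 2 r ψ) = cuspCoeff g r • ψ} := by
  intro D
  induction D using Nat.strong_induction_on with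
  | _ D ih =>
    intro hDsq hDM₀ hDat hdec L _ hL
    by_cases hD1 : D = 1
    · -- base: `D = 1`, `G = g`
      subst hD1
      obtain rfl : L = M₀ := by rw [hL, mul_one]
      refine ⟨g, hg.2.1, hg.2.2, valuation_cuspCoeff_le_one_of_isNewform0 hg ι,
        IsNewform0.finiteDimensional_coeffField_holds hg, hasSimpleHeckeGenEigenspace_of_isNewform0 hg,
        fun q _ _ ↦ rfl, fun q hp hp1 ↦ absurd (Nat.eq_one_of_dvd_one hp1) hp.ne_one, ?_⟩
      refine Submodule.subset_span ⟨hg.cuspCoeff_im_eq_zero, fun r hr _ ↦ ?_⟩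
      haveI : NeZero r := ⟨hr.ne_zero⟩
      exact hg.heckeT_eq_coeff_smul hr
    · -- step: `D = ℓ D'` with `ℓ` prime, `ℓ ∤ D'`
      obtain ⟨ℓ, hℓ, hℓD⟩ := Nat.exists_prime_and_dvd hD1
      obtain ⟨D', rfl⟩ := hℓD
      have hsq := Nat.squarefree_mul_iff.mp hDsq
      obtain ⟨hℓD', -, hD'sq⟩ := hsq
      have hℓD'' : ¬ ℓ ∣ D' := fun h ↦ hℓ.ne_one (Nat.Coprime.eq_one_of_dvd hℓD' h)
      have hD'M₀ : Nat.Coprime D' M₀ := Nat.Coprime.coprime_dvd_left (dvd_mul_left D' ℓ) hDM₀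
      have hℓM₀ : ¬ ℓ ∣ M₀ := fun h ↦
        hℓ.ne_one (Nat.Coprime.eq_one_of_dvd (Nat.Coprime.coprime_dvd_left (dvd_mul_right ℓ D') hDM₀) h)
      have hD'0 : D' ≠ 0 := Squarefree.ne_zero hD'sq
      haveI : NeZero D' := ⟨hD'0⟩
      haveI : NeZero ℓ := ⟨hℓ.ne_zero⟩
      have hD'lt : D' < ℓ * D' := by
        have := hℓ.two_le
        have hpos := Nat.pos_of_ne_zero hD'0
        nlinarith
      -- the form at level `M₀ D'`
      obtain ⟨G', hG'eig, hG'norm, hG'int, hG'fd, hG'C, hG'g, hG'f, hG'span⟩ :=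
        ih D' hD'lt hD'sq hD'M₀ (fun q hp hpD' ↦ hDat q hp (hpD'.mul_left ℓ))
          (fun q hp hpD' ↦ hdec q hp (hpD'.mul_left ℓ)) (M₀ * D') rfl
      have hℓL' : ¬ ℓ ∣ M₀ * D' := by
        intro h
        rcases (Nat.Prime.dvd_mul hℓ).mp h with h | h
        · exact hℓM₀ h
        · exact hℓD'' h
      have hM₀L' : M₀ ∣ M₀ * D' := dvd_mul_right M₀ D'
      have h1 : M₀ * D' * 1 ∣ M₀ * D' * ℓ := mul_dvd_mul_left _ (one_dvd ℓ)
      have hℓℓ : M₀ * D' * ℓ ∣ M₀ * D' * ℓ := dvd_rfl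
      -- the root `β ≡ uℓ` and the DECISION `α ≠ β`
      obtain ⟨u, hu, hafℓ, haℓ⟩ := hDat ℓ hℓ (dvd_mul_right ℓ D')
      have hGℓ : cuspCoeff G' ℓ = cuspCoeff g ℓ := hG'g ℓ hℓ hℓD''
      have haℓ' : Valued.v (ι.symm (cuspCoeff G' ℓ - u * (ℓ + 1))) < 1 := by rw [hGℓ]; exact haℓ
      obtain ⟨β, hβ, hβℓ, hα⟩ := exists_root_valuation_sub_lt_one_sign ι (hG'int ℓ) ℓ hu haℓ'
      have hne : cuspCoeff G' ℓ - β ≠ β := by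
        rw [hGℓ]
        exact hdec ℓ hℓ (dvd_mul_right ℓ D') u β hu hafℓ haℓ (by rw [← hGℓ]; exact hβ) hβℓ
      -- the data of the new form `G = ι₁ G' − β ι_ℓ G'` at level `M₀ D' ℓ = L`
      have hGeig : IsHeckeEigenform (iota (M₀ * D') (M₀ * D' * ℓ) 1 2 h1 G' - β • iota (M₀ * D') (M₀ * D' * ℓ) ℓ 2 hℓℓ G') :=
        isHeckeEigenform_stab_eig hG'eig hG'norm β h1 hℓℓ hℓ hℓL' hβ
      have hGnorm : IsNormalized (iota (M₀ * D') (M₀ * D' * ℓ) 1 2 h1 G' - β • iota (M₀ * D') (M₀ * D' * ℓ) ℓ 2 hℓℓ G') :=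
        isNormalized_stab G' β h1 hℓℓ hG'norm hℓ
      have hGint : ∀ n : ℕ, Valued.v (ι.symm (cuspCoeff
          (iota (M₀ * D') (M₀ * D' * ℓ) 1 2 h1 G' - β • iota (M₀ * D') (M₀ * D' * ℓ) ℓ 2 hℓℓ G') n)) ≤ 1 :=
        valuation_cuspCoeff_stab_le_one ι β h1 hℓℓ hG'int hβ
      have hGfd : FiniteDimensional ℚ
          (coeffField (iota (M₀ * D') (M₀ * D' * ℓ) 1 2 h1 G' - β • iota (M₀ * D') (M₀ * D' * ℓ) ℓ 2 hℓℓ G')) :=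
        finiteDimensional_coeffField_stab_eig β h1 hℓℓ hG'fd hβ
      have hGC : HasSimpleHeckeGenEigenspace
          (iota (M₀ * D') (M₀ * D' * ℓ) 1 2 h1 G' - β • iota (M₀ * D') (M₀ * D' * ℓ) ℓ 2 hℓℓ G') :=
        hasSimpleHeckeGenEigenspace_stab_of_hasSimpleHeckeGenEigenspace hg h1 hℓℓ hM₀L' hG'eig hG'norm hG'C
          (fun q hp hpL' ↦ hG'g q hp fun h ↦ hpL' (h.mul_left M₀)) hℓ hℓL' hβ hne
      have hGp : ∀ {q : ℕ}, q.Prime →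
          cuspCoeff (iota (M₀ * D') (M₀ * D' * ℓ) 1 2 h1 G' - β • iota (M₀ * D') (M₀ * D' * ℓ) ℓ 2 hℓℓ G') q =
            if q = ℓ then cuspCoeff G' ℓ - β else cuspCoeff G' q :=
        fun hp ↦ cuspCoeff_stab_prime_eig hG'norm β h1 hℓℓ hℓ hp
      have hGspan : ∀ {d : ℕ} [NeZero d] (hd : M₀ * D' * d ∣ M₀ * D' * ℓ), d = 1 ∨ d = ℓ →
          iota (M₀ * D') (M₀ * D' * ℓ) d 2 hd G' ∈ Submodule.span ℂ {ψ' : CuspForm (Gamma0 (M₀ * D' * ℓ)) 2 |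
            (∀ m, (cuspCoeff ψ' m).im = 0) ∧ ∀ (r : ℕ) (hr : r.Prime), ¬ r ∣ M₀ * D' * ℓ →
              (haveI : NeZero r := ⟨hr.ne_zero⟩; heckeT (Gamma0 (M₀ * D' * ℓ)) 2 r ψ') = cuspCoeff g r • ψ'} := by
        intro d _ hd hdℓ
        refine (Submodule.map_span_le (iota (M₀ * D') (M₀ * D' * ℓ) d 2 hd) _ _ |>.mpr ?_)
          (Submodule.mem_map_of_mem hG'span)
        rintro ψ ⟨hreal, hT⟩
        exact iota_mem_span_realEigen (fun r ↦ cuspCoeff g r) hℓ hd hdℓ hreal hT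
      obtain rfl : L = M₀ * D' * ℓ := by rw [hL]; ring
      refine ⟨iota (M₀ * D') (M₀ * D' * ℓ) 1 2 h1 G' - β • iota (M₀ * D') (M₀ * D' * ℓ) ℓ 2 hℓℓ G',
        hGeig, hGnorm, hGint, hGfd, hGC, fun q hp hpD ↦ ?_, fun q hp hpD ↦ ?_,
        Submodule.sub_mem _ (hGspan h1 (Or.inl rfl)) (Submodule.smul_mem _ _ (hGspan hℓℓ (Or.inr rfl)))⟩
      · -- `a_p(G) = a_p(g)` off `D = ℓ D'`
        have hpℓ : q ≠ ℓ := by rintro rfl; exact hpD (dvd_mul_right q D')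
        have hpD' : ¬ q ∣ D' := fun h ↦ hpD (h.mul_left ℓ)
        rw [hGp hp, if_neg hpℓ, hG'g q hp hpD']
      · -- `a_p(G) ≡ af q` on `D`
        rw [hGp hp]
        by_cases hpℓ : q = ℓ
        · subst hpℓ
          rw [if_pos rfl, hafℓ]
          have : ι.symm ((u : ℂ) - (cuspCoeff G' q - β)) = -ι.symm (cuspCoeff G' q - β - u) := by
            rw [← map_neg]; congr 1; ring
          rw [this, Valuation.map_neg]
          exact hα
        · rw [if_neg hpℓ]
          have hpD' : q ∣ D' := by
            rcases (Nat.Prime.dvd_mul hp).mp hpD with h | h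
            · exact absurd ((Nat.prime_dvd_prime_iff_eq hp hℓ).mp h) hpℓ
            · exact h
          exact hG'f q hp hpD'

/-- ★ **THE CE-FREE `k`-FOLD STABILISATION at primes `q ≢ 1 (mod p)`.** As `exists_multiStab`, WITHOUT the named fact
`colemanEdixhoven1998_heckePolynomial_simpleRoots`, under the side condition that every prime `q ∣ D` has `q % p ≠ 1` (allowed:
`q = p`): the decision `α_q ≠ β_q` is then read off the congruences `α_q ≡ u_q`, `β_q ≡ u_q q` (`sub_ne_of_emod_ne_one`).
[cite: Vatsal1999, (1.2) Condition 1] [cite: DiamondShurman2005, §5.7 and Prop. 5.6.2] [cite: Shimura1971, Thm. 3.48] -/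
theorem exists_multiStab_of_emod_ne_one (ι : PadicAlgCl p ≃+* ℂ) (af : ℕ → ℂ) {D : ℕ} (hDsq : Squarefree D)
    (hDM₀ : Nat.Coprime D M₀)
    (hDat : ∀ q : ℕ, q.Prime → q ∣ D → ∃ u : ℤ, u * u = 1 ∧ af q = u ∧
      Valued.v (ι.symm (cuspCoeff g q - u * (q + 1))) < 1)
    (hD1 : ∀ q : ℕ, q.Prime → q ∣ D → q % p ≠ 1) (L : ℕ) [NeZero L] (hL : L = M₀ * D) :
    ∃ G : CuspForm (Gamma0 L) 2,
      IsHeckeEigenform G ∧ IsNormalized G ∧ (∀ n : ℕ, Valued.v (ι.symm (cuspCoeff G n)) ≤ 1) ∧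
      FiniteDimensional ℚ (coeffField G) ∧ HasSimpleHeckeGenEigenspace G ∧
      (∀ q : ℕ, q.Prime → ¬ q ∣ D → cuspCoeff G q = cuspCoeff g q) ∧
      (∀ q : ℕ, q.Prime → q ∣ D → Valued.v (ι.symm (af q - cuspCoeff G q)) < 1) ∧
      G ∈ Submodule.span ℂ {ψ : CuspForm (Gamma0 L) 2 | (∀ m, (cuspCoeff ψ m).im = 0) ∧
        ∀ (r : ℕ) (hr : r.Prime), ¬ r ∣ L →
          (haveI : NeZero r := ⟨hr.ne_zero⟩; heckeT (Gamma0 L) 2 r ψ) = cuspCoeff g r • ψ} :=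
  exists_multiStab_of_rootNe hg ι af D hDsq hDM₀ hDat
    (fun q hq hqD _ _ hu _ haq _ hβq ↦ sub_ne_of_emod_ne_one ι hu (hD1 q hq hqD) haq hβq) L hL

end Induction

end Summit.BirchSwinnertonDyer.BirchSwinnertonDyer.Theorems.GL1Cartan.Exc

end
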